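import Summits.CriticalPhenomena.SAWScalingLimit.Theorems.SAWTotalPositivityBoundaryTP2Defs
import Summits.CriticalPhenomena.SAWScalingLimit.Theorems.SAWTotalPositivityBoundaryTP2SquareGadget
import Summits.CriticalPhenomena.SAWScalingLimit.Theorems.SAWTotalPositivityBoundaryTP2CutVertex
import Summits.CriticalPhenomena.SAWScalingLimit.Theorems.SAWTotalPositivityBoundaryTP2RectReflect
import Summits.CriticalPhenomena.SAWScalingLimit.Theorems.SAWTotalPositivityBoundaryTP2LadderKernelsInteriorRec
import Summits.CriticalPhenomena.SAWScalingLimit.Theorems.EdgeOfPositivity.Negative.EdgeOfPositivityRectDomain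
import HarnessLib

/-!
# Crux `BoundaryTP2` (stmt-CriticalPhenomena-7115), line `Sketch`: all two-point kernels of the ladders

Tool stub `stub_ladderKernels_interior` of the line's skeleton: on the ladder
`R_L = discreteDomainGraph (rectDomain L 1) 1` (sites `{0..L} × {0,1}`) the fugacity-`x` self-avoiding
path kernel between `(i,r)` and `(j,s)`, `i < j ≤ L`, `r, s ∈ {0,1}`, is

  `x^{j-i} (F^{ε}_{j-i+1} + (E_i + E_{L-j}) F^{-ε}_{j-i} + E_i E_{L-j} F^{ε}_{j-i-1})`,

`E_k = Σ_{d<k} x^{2d+3}`, `F^{ε}_n = ((1+x)^n + ε (1-x)^n)/2`, `ε = +1` if `r = s`, `-1` otherwise.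

Proof. Reverse the paths and take the first step at `b = (j,s)`. If `j = L` this is the last-column
recursion `ladderInt_rec`. If `j < L`, `b` has the three neighbours `(j-1,s)`, `c = (j,1-s)`, `(j+1,s)`
(`ladderInt_firstStep_triple`), and in `R' = R_L - b` the site `c` is a cut vertex between the left block
`A = {v₀ ≤ j-1} ∪ {c}` and the right block `B = {v₀ ≥ j}`:
* paths from `(j-1,s)` to `(i,r)` stay in the left block (`ladderInt_pathKernel_eq_of_block`: a path
  leaving a block through its unique exit vertex cannot come back), whose graph is `R_j - b`, in which
  `c` is a leaf: the term is `Z_{R_{j-1}}((i,r),(j-1,s))`;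
* paths from `c` factor through the cut vertex trivially (`stub_cutVertex_factor`), giving
  `x Z_{R_{j-1}}((i,r),(j-1,1-s))`;
* paths from `(j+1,s)` factor as `Z_{R'[B]}((j+1,s),c) · Z_{R'[A]}(c,(i,r))`; the first factor is `x`
  times the end rung of the ladder on the columns `j+1..L`, isomorphic (by a reflection) to `R_{L-j-1}`:
  `x (x + E_{L-j-1})` (`ladderInt_rungEnd`, `pathKernel_map_iso`).
Since `x + x · x (x + E_{L-j-1}) = x + E_{L-j}`, in both cases
`Z = x (Z_{R_{j-1}}((i,r),(j-1,s)) + (x + E_{L-j}) Z_{R_{j-1}}((i,r),(j-1,1-s)))` (`ladderInt_twoTerm`),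
and the end-column kernels `ladderInt_endKernel` finish the computation.
-/

noncomputable section

namespace Summit.CriticalPhenomena.SAWScalingLimit.Theorems.BoundaryTP2

open Literature.Probability.LatticeModels Literature.Probability.RandomPlanarGeometry
open Summit.CriticalPhenomena.SAWScalingLimit.Theorems.EdgeOfPositivity.Negative
open scoped ENNReal

variable {V : Type*}

/-! ## Generic tools: blocks with a single exit vertex, first step at a vertex of degree three -/

/-- If every edge of `H` leaving the vertex set `S` starts at the single vertex `c`, a walk from
outside `S` to a vertex of `S` visits `c`. [folklore] -/
private theorem ladderInt_block_enter {H : SimpleGraph V} {S : Set V} {c : V}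
    (hS : ∀ u v, H.Adj u v → u ∈ S → v ∉ S → u = c) :
    ∀ {u b : V} (q : H.Walk u b), u ∉ S → b ∈ S → c ∈ q.support := by
  intro u b q
  induction q with
  | nil => intro hu hb; exact absurd hb hu
  | @cons u' v' w' h q' ih =>
    intro hu hb
    rw [SimpleGraph.Walk.support_cons, List.mem_cons]
    by_cases hv : v' ∈ S
    · obtain rfl := hS _ _ h.symm hv hu
      exact Or.inr q'.start_mem_support
    · exact Or.inr (ih hv hb)

/-- If every edge of `H` leaving `S` starts at the single vertex `c`, a self-avoiding path between two
vertices of `S` stays in `S` (leaving and re-entering would visit `c` twice). [folklore] -/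
private theorem ladderInt_block_support_subset {H : SimpleGraph V} {S : Set V} {c : V}
    (hS : ∀ u v, H.Adj u v → u ∈ S → v ∉ S → u = c) :
    ∀ {a b : V} (p : H.Walk a b), p.IsPath → a ∈ S → b ∈ S → ∀ w, w ∈ p.support → w ∈ S := by
  intro a b p
  induction p with
  | nil =>
    intro _ ha _ w hw
    rw [SimpleGraph.Walk.support_nil, List.mem_singleton] at hw
    subst hw
    exact ha
  | @cons u' v' w' h q' ih =>
    intro hp ha hb w hw
    rw [SimpleGraph.Walk.cons_isPath_iff] at hp
    rw [SimpleGraph.Walk.support_cons, List.mem_cons] at hw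
    rcases hw with rfl | hw
    · exact ha
    · by_cases hv : v' ∈ S
      · exact ih hp.1 hv hb w hw
      · obtain rfl := hS _ _ h ha hv
        exact absurd (ladderInt_block_enter hS q' hv hb) hp.2

/-- **Kernels inside a block with a single exit vertex.** If every edge of `H` leaving the vertex set
`S` starts at one and the same vertex `c`, then for `a, b ∈ S` the kernel `Z_H(a,b)` equals the kernel
of any subgraph `G ≤ H` containing the edges of `H` inside `S`: a self-avoiding path between vertices
of `S` never leaves `S`. [folklore] -/
theorem ladderInt_pathKernel_eq_of_block {H G : SimpleGraph V} {S : Set V} {c : V}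
    (hS : ∀ u v, H.Adj u v → u ∈ S → v ∉ S → u = c) (hGH : G ≤ H)
    (hHG : ∀ u v, H.Adj u v → u ∈ S → v ∈ S → G.Adj u v) (x : ℝ) {a b : V} (ha : a ∈ S)
    (hb : b ∈ S) : pathKernel H x a b = pathKernel G x a b := by
  refine le_antisymm ?_ (pathKernel_mono hGH x a b)
  have hedges : ∀ γ : H.Path a b, ∀ e, e ∈ γ.1.edges → e ∈ G.edgeSet := by
    intro γ e he
    have hsub := ladderInt_block_support_subset hS γ.1 γ.2 ha hb
    induction e using Sym2.ind with
    | _ u v =>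
      exact hHG u v (γ.1.adj_of_mem_edges he) (hsub u (γ.1.fst_mem_support_of_mem_edges he))
        (hsub v (γ.1.snd_mem_support_of_mem_edges he))
  let F : H.Path a b → G.Path a b := fun γ => ⟨γ.1.transfer G (hedges γ), γ.2.transfer _⟩
  have hF : Function.Injective F := by
    intro γ γ' h
    have h1 := congrArg (fun δ : G.Path a b => δ.1.edges) h
    simp only [F, SimpleGraph.Walk.edges_transfer] at h1
    exact Subtype.ext (SimpleGraph.Walk.edges_injective h1)
  calc pathKernel H x a b = ∑' γ : H.Path a b, ENNReal.ofReal (x ^ (F γ).1.length) := by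
        unfold pathKernel
        refine tsum_congr fun γ => ?_
        rw [SimpleGraph.Walk.length_transfer]
    _ ≤ ∑' δ : G.Path a b, ENNReal.ofReal (x ^ δ.1.length) :=
        ENNReal.tsum_comp_le_tsum_of_injective hF (fun δ : G.Path a b => ENNReal.ofReal (x ^ δ.1.length))
    _ = pathKernel G x a b := rfl

/-- **First step at a vertex with exactly three neighbours.** If `N_H(a) = {v₁, v₂, v₃}` (pairwise
distinct) and `a ≠ b`, then `Z_H(a,b) = x · (Z_{H-a}(v₁,b) + Z_{H-a}(v₂,b) + Z_{H-a}(v₃,b))` (`0 ≤ x`).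
[folklore] -/
theorem ladderInt_firstStep_triple [DecidableEq V] (H : SimpleGraph V) (x : ℝ) (hx : 0 ≤ x)
    {a b v₁ v₂ v₃ : V} (hab : a ≠ b) (h₁₂ : v₁ ≠ v₂) (h₁₃ : v₁ ≠ v₃) (h₂₃ : v₂ ≠ v₃)
    (hN : H.neighborSet a = {v₁, v₂, v₃}) :
    pathKernel H x a b = ENNReal.ofReal x *
      (pathKernel (H.deleteEdges (H.incidenceSet a)) x v₁ b +
        (pathKernel (H.deleteEdges (H.incidenceSet a)) x v₂ b +
          pathKernel (H.deleteEdges (H.incidenceSet a)) x v₃ b)) := by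
  have h₁ : H.Adj a v₁ := by rw [← SimpleGraph.mem_neighborSet, hN]; exact Set.mem_insert _ _
  have h₂ : H.Adj a v₂ := by
    rw [← SimpleGraph.mem_neighborSet, hN]; exact Set.mem_insert_of_mem _ (Set.mem_insert _ _)
  have h₃ : H.Adj a v₃ := by
    rw [← SimpleGraph.mem_neighborSet, hN]
    exact Set.mem_insert_of_mem _ (Set.mem_insert_of_mem _ (Set.mem_singleton _))
  rw [stub_pathKernel_firstStep H x hx a b hab]
  congr 1
  set f : V → ℝ≥0∞ := fun u => pathKernelOn H x u b {γ | a ∉ γ.1.support} with hf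
  have hcoe : H.neighborSet a = ((({v₁, v₂, v₃} : Finset V) : Set V)) := by
    rw [hN, Finset.coe_insert, Finset.coe_pair]
  calc ∑' u : H.neighborSet a, pathKernelOn H x u b {γ | a ∉ γ.1.support}
      = ∑' u : H.neighborSet a, f u := rfl
    _ = ∑' u : ((({v₁, v₂, v₃} : Finset V) : Set V)), f u := tsum_congr_set_coe f hcoe
    _ = ∑ u ∈ ({v₁, v₂, v₃} : Finset V), f u := Finset.tsum_subtype' _ f
    _ = f v₁ + (f v₂ + f v₃) := by
        rw [Finset.sum_insert (by simp [h₁₂, h₁₃]), Finset.sum_pair h₂₃]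
    _ = _ := by
        simp only [hf]
        rw [stub_pathKernelOn_avoid H x v₁ b a h₁.ne.symm hab.symm,
          stub_pathKernelOn_avoid H x v₂ b a h₂.ne.symm hab.symm,
          stub_pathKernelOn_avoid H x v₃ b a h₃.ne.symm hab.symm]

/-- Adjacency of the piece of `H` on a vertex set `S` (the `fromRel` graph of `stub_cutVertex_factor`).
[folklore] -/
private theorem ladderInt_adj_fromRel_and (H : SimpleGraph V) (S : Set V) (u v : V) :
    (SimpleGraph.fromRel fun u v => H.Adj u v ∧ u ∈ S ∧ v ∈ S).Adj u v ↔ H.Adj u v ∧ u ∈ S ∧ v ∈ S := by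
  rw [SimpleGraph.fromRel_adj]
  constructor
  · rintro ⟨-, ⟨h, hu, hv⟩ | ⟨h, hv, hu⟩⟩
    · exact ⟨h, hu, hv⟩
    · exact ⟨h.symm, hu, hv⟩
  · rintro ⟨h, hu, hv⟩
    exact ⟨h.ne, Or.inl ⟨h, hu, hv⟩⟩

/-! ## The first step at an interior column -/

/-- **Three-term decomposition at an interior column.** For `i ≤ k` and the ladder `R_{k+2+m}`:
`Z((i,r),(k+1,s)) = x (Z_{R_k}((i,r),(k,s)) + (x + E_{m+1}) Z_{R_k}((i,r),(k,1-s)))`,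
`E_{m+1} = Σ_{d ≤ m} x^{2d+3}` (first step at `(k+1,s)`; cut vertex `(k+1,1-s)` of `R - (k+1,s)`; the
right block contributes `x` times the end rung `x + E_m` of a reflected copy of `R_m`). [folklore] -/
theorem ladderInt_threeTerm (i k m : ℕ) (hik : i ≤ k) {x : ℝ} (hx : 0 ≤ x) (r s : ℤ)
    (hs : s = 0 ∨ s = 1) :
    pathKernel (discreteDomainGraph (rectDomain (k + 2 + m) 1) 1) x (st i r) (st (k + 1 : ℕ) s) =
      ENNReal.ofReal x *
        (pathKernel (discreteDomainGraph (rectDomain k 1) 1) x (st i r) (st k s) +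
          ENNReal.ofReal (x + ∑ d ∈ Finset.range (m + 1), x ^ (2 * d + 3)) *
            pathKernel (discreteDomainGraph (rectDomain k 1) 1) x (st i r) (st k (1 - s))) := by
  classical
  set R := discreteDomainGraph (rectDomain (k + 2 + m) 1) 1 with hR_def
  -- the sites involved
  set a : Site 2 := st i r with ha_def
  set b : Site 2 := st (k + 1 : ℕ) s with hb_def
  set c : Site 2 := st (k + 1 : ℕ) (1 - s) with hc_def
  set u₁ : Site 2 := st k s with hu₁_def
  set u₃ : Site 2 := st (k + 2 : ℕ) s with hu₃_def
  set u₄ : Site 2 := st (k + 2 : ℕ) (1 - s) with hu₄_def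
  have hba : b ≠ a := by
    rw [hb_def, ha_def, Ne, ladderInt_eq_st_iff, st_zero]; push_cast; omega
  have hca : c ≠ a := by
    rw [hc_def, ha_def, Ne, ladderInt_eq_st_iff, st_zero]; push_cast; omega
  have h1c : u₁ ≠ c := by
    rw [hu₁_def, hc_def, Ne, ladderInt_eq_st_iff, st_zero]; push_cast; omega
  have h13 : u₁ ≠ u₃ := by
    rw [hu₁_def, hu₃_def, Ne, ladderInt_eq_st_iff, st_zero]; push_cast; omega
  have hc3 : c ≠ u₃ := by
    rw [hc_def, hu₃_def, Ne, ladderInt_eq_st_iff, st_zero]; push_cast; omega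
  -- first step at `b`
  have hN : R.neighborSet b = {u₁, c, u₃} := by
    ext v
    rw [SimpleGraph.mem_neighborSet, hR_def, ladderInt_adj_iff, Set.mem_insert_iff, Set.mem_insert_iff,
      Set.mem_singleton_iff, hu₁_def, hc_def, hu₃_def, hb_def, ladderInt_eq_st_iff, ladderInt_eq_st_iff,
      ladderInt_eq_st_iff]
    simp only [st_zero, st_one]
    push_cast
    omega
  rw [pathKernel_comm R x a b, ladderInt_firstStep_triple R x hx hba h1c h13 hc3 hN]
  set R' := R.deleteEdges (R.incidenceSet b) with hR'_def
  have hR'adj : ∀ u v, R'.Adj u v ↔ R.Adj u v ∧ u ≠ b ∧ v ≠ b := deleteEdges_incidenceSet_adj R b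
  -- the left block `A`, the right block `B`, the cut vertex `c`
  set A : Set (Site 2) := {v | v 0 ≤ k ∨ v = c} with hA_def
  set B : Set (Site 2) := {v | (k : ℤ) + 1 ≤ v 0} with hB_def
  have haA : a ∈ A := Or.inl (by rw [ha_def, st_zero]; exact_mod_cast hik)
  have hu₁A : u₁ ∈ A := Or.inl (by rw [hu₁_def, st_zero])
  have hcA : c ∈ A := Or.inr rfl
  have hcB : c ∈ B := by
    show (k : ℤ) + 1 ≤ c 0
    rw [hc_def, st_zero]; push_cast; exact le_rfl
  have hu₃B : u₃ ∈ B := by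
    show (k : ℤ) + 1 ≤ u₃ 0
    rw [hu₃_def, st_zero]; push_cast; omega
  have hAB : ∀ v, v ∈ A ∨ v ∈ B := by
    intro v
    simp only [hA_def, hB_def, Set.mem_setOf_eq]
    omega
  have hc : ∀ v, v ∈ A → v ∈ B → v = c := by
    intro v hvA hvB
    simp only [hA_def, hB_def, Set.mem_setOf_eq, hc_def, ladderInt_eq_st_iff] at hvA hvB ⊢
    push_cast at hvA ⊢
    omega
  have hS : ∀ u v, R'.Adj u v → u ∈ A → v ∉ A → u = c := by
    intro u v huv hu hv
    rw [hR'adj, hR_def, ladderInt_adj_iff, hb_def, Ne, Ne, ladderInt_eq_st_iff, ladderInt_eq_st_iff] at huv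
    simp only [hA_def, Set.mem_setOf_eq, hc_def, ladderInt_eq_st_iff] at hu hv ⊢
    push_cast at huv hu hv ⊢
    omega
  have hsep : ∀ u v, R'.Adj u v → (u ∈ A ∧ v ∈ A) ∨ (u ∈ B ∧ v ∈ B) := by
    intro u v huv
    rw [hR'adj, hR_def, ladderInt_adj_iff, hb_def, Ne, Ne, ladderInt_eq_st_iff, ladderInt_eq_st_iff] at huv
    simp only [hA_def, hB_def, Set.mem_setOf_eq, hc_def, ladderInt_eq_st_iff]
    push_cast at huv ⊢
    omega
  -- the left block is `R_{k+1} - b`, in which `c` is a leaf hanging on `(k,1-s)`; removing it leaves `R_k`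
  set Rk1b := (discreteDomainGraph (rectDomain (k + 1) 1) 1).deleteEdges
    ((discreteDomainGraph (rectDomain (k + 1) 1) 1).incidenceSet b) with hRk1b_def
  have hGH : Rk1b ≤ R' := by
    intro u v huv
    rw [hRk1b_def, deleteEdges_incidenceSet_adj, ladderInt_adj_iff, hb_def, Ne, Ne, ladderInt_eq_st_iff,
      ladderInt_eq_st_iff] at huv
    rw [hR'adj, hR_def, ladderInt_adj_iff, hb_def, Ne, Ne, ladderInt_eq_st_iff, ladderInt_eq_st_iff]
    push_cast at huv ⊢
    omega
  have hHG : ∀ u v, R'.Adj u v → u ∈ A → v ∈ A → Rk1b.Adj u v := by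
    intro u v huv hu hv
    rw [hR'adj, hR_def, ladderInt_adj_iff, hb_def, Ne, Ne, ladderInt_eq_st_iff, ladderInt_eq_st_iff] at huv
    simp only [hA_def, Set.mem_setOf_eq, hc_def, ladderInt_eq_st_iff] at hu hv
    rw [hRk1b_def, deleteEdges_incidenceSet_adj, ladderInt_adj_iff, hb_def, Ne, Ne, ladderInt_eq_st_iff,
      ladderInt_eq_st_iff]
    push_cast at huv hu hv ⊢
    omega
  have hRA : (SimpleGraph.fromRel fun u v => R'.Adj u v ∧ u ∈ A ∧ v ∈ A) = Rk1b := by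
    ext u v
    rw [ladderInt_adj_fromRel_and]
    constructor
    · rintro ⟨huv, hu, hv⟩
      exact hHG u v huv hu hv
    · intro huv
      have huv' := hGH huv
      rw [hRk1b_def, deleteEdges_incidenceSet_adj, ladderInt_adj_iff, hb_def, Ne, Ne, ladderInt_eq_st_iff,
        ladderInt_eq_st_iff] at huv
      simp only [hA_def, Set.mem_setOf_eq, hc_def, ladderInt_eq_st_iff]
      push_cast at huv ⊢
      refine ⟨huv', ?_, ?_⟩ <;> omega
  have hN' : Rk1b.neighborSet c = {st k (1 - s)} := ladderInt_hanging_neighborSet k s hs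
  have hleaf : ∀ z, Rk1b.Adj c z → z = st k (1 - s) := fun z hz => by
    have hz' : z ∈ Rk1b.neighborSet c := hz
    rwa [hN', Set.mem_singleton_iff] at hz'
  have hRk : Rk1b.deleteEdges (Rk1b.incidenceSet c) = discreteDomainGraph (rectDomain k 1) 1 :=
    ladderInt_delete_lastColumn k s hs
  -- term 1: from `(k,s)`, inside the left block
  have T1 : pathKernel R' x u₁ a = pathKernel (discreteDomainGraph (rectDomain k 1) 1) x a u₁ := by
    rw [ladderInt_pathKernel_eq_of_block hS hGH hHG x hu₁A haA,
      pathKernel_eq_deleteVert_of_leaf Rk1b x hleaf h1c hca.symm, hRk, pathKernel_comm]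
  -- the kernel of the left block into the cut vertex
  have hAc : pathKernel (SimpleGraph.fromRel fun u v => R'.Adj u v ∧ u ∈ A ∧ v ∈ A) x a c =
      ENNReal.ofReal x * pathKernel (discreteDomainGraph (rectDomain k 1) 1) x a (st k (1 - s)) := by
    rw [hRA, pathKernel_comm, pathKernel_firstStep_single Rk1b x hx hca hN', hRk, pathKernel_comm]
  -- term 2: from the cut vertex
  have T2 : pathKernel R' x c a =
      ENNReal.ofReal x * pathKernel (discreteDomainGraph (rectDomain k 1) 1) x a (st k (1 - s)) := by
    rw [pathKernel_comm, stub_cutVertex_factor R' x hx A B c a c hAB hc hcA hcB hsep haA hcB,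
      pathKernel_self, mul_one, hAc]
  -- the right block: `c` is a leaf hanging on `(k+2,1-s)`, and removing it leaves the ladder on the
  -- columns `k+2..k+2+m`, a reflected copy of `R_m`
  set RB := SimpleGraph.fromRel fun u v => R'.Adj u v ∧ u ∈ B ∧ v ∈ B with hRB_def
  have hRBadj : ∀ u v, RB.Adj u v ↔ R'.Adj u v ∧ u ∈ B ∧ v ∈ B := ladderInt_adj_fromRel_and R' B
  have hNB : RB.neighborSet c = {u₄} := by
    ext v
    rw [SimpleGraph.mem_neighborSet, hRBadj, hR'adj, hR_def, ladderInt_adj_iff, Set.mem_singleton_iff,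
      hu₄_def, hb_def, hc_def, Ne, Ne, ladderInt_eq_st_iff, ladderInt_eq_st_iff, ladderInt_eq_st_iff]
    simp only [hB_def, Set.mem_setOf_eq, st_zero, st_one]
    push_cast
    omega
  have hinv : Function.Involutive (fun v : Site 2 => st ((k + 2 + m : ℕ) - v 0) (v 1)) := by
    intro v
    simp only [st_zero, st_one, sub_sub_cancel]
    exact st_eta v
  let φ : RB.deleteEdges (RB.incidenceSet c) ≃g discreteDomainGraph (rectDomain m 1) 1 :=
    { toEquiv := hinv.toPerm _
      map_rel_iff' := by
        intro u v
        rw [Function.Involutive.coe_toPerm, ladderInt_adj_iff, deleteEdges_incidenceSet_adj, hRBadj,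
          hR'adj, hR_def, ladderInt_adj_iff, hb_def, hc_def, Ne, Ne, Ne, Ne, ladderInt_eq_st_iff,
          ladderInt_eq_st_iff, ladderInt_eq_st_iff, ladderInt_eq_st_iff]
        simp only [hB_def, Set.mem_setOf_eq, st_zero, st_one]
        push_cast
        omega }
  have hφ : ∀ v, φ v = st ((k + 2 + m : ℕ) - v 0) (v 1) := fun v => rfl
  have hφ₄ : φ u₄ = st m (1 - s) := by
    rw [hφ, hu₄_def, st_zero, st_one]; push_cast; ring_nf
  have hφ₃ : φ u₃ = st m s := by
    rw [hφ, hu₃_def, st_zero, st_one]; push_cast; ring_nf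
  have hBc : pathKernel RB x c u₃ =
      ENNReal.ofReal x * ENNReal.ofReal (x + ∑ d ∈ Finset.range m, x ^ (2 * d + 3)) := by
    rw [pathKernel_firstStep_single RB x hx hc3 hNB, ← pathKernel_map_iso φ x u₄ u₃, hφ₄, hφ₃,
      ladderInt_rungEnd m hx (1 - s) s (by omega) (by omega)]
  -- term 3: from `(k+2,s)`, through the cut vertex
  have T3 : pathKernel R' x u₃ a =
      ENNReal.ofReal x * pathKernel (discreteDomainGraph (rectDomain k 1) 1) x a (st k (1 - s)) *
        (ENNReal.ofReal x * ENNReal.ofReal (x + ∑ d ∈ Finset.range m, x ^ (2 * d + 3))) := by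
    rw [pathKernel_comm, stub_cutVertex_factor R' x hx A B c a u₃ hAB hc hcA hcB hsep haA hu₃B, hAc, hBc]
  -- assemble
  rw [T1, T2, T3]
  congr 1
  rw [hu₁_def]
  congr 1
  set G := pathKernel (discreteDomainGraph (rectDomain k 1) 1) x a (st k (1 - s))
  set U := ∑ d ∈ Finset.range m, x ^ (2 * d + 3)
  have hU : 0 ≤ x + U := add_nonneg hx (Finset.sum_nonneg fun d _ => pow_nonneg hx _)
  rw [show ENNReal.ofReal x * G + ENNReal.ofReal x * G * (ENNReal.ofReal x * ENNReal.ofReal (x + U)) =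
      ENNReal.ofReal x * (1 + ENNReal.ofReal x * ENNReal.ofReal (x + U)) * G by ring]
  congr 1
  rw [← ENNReal.ofReal_mul hx, ← ENNReal.ofReal_one, ← ENNReal.ofReal_add zero_le_one (mul_nonneg hx hU),
    ← ENNReal.ofReal_mul hx]
  congr 1
  rw [Finset.sum_range_succ', ← ladderInt_excursion_shift]
  ring

/-- **Two-term recursion at any column.** For `i ≤ k < L`,
`Z_{R_L}((i,r),(k+1,s)) = x (Z_{R_k}((i,r),(k,s)) + (x + E_{L-k-1}) Z_{R_k}((i,r),(k,1-s)))`: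
the last-column recursion if `k + 1 = L`, the three-term decomposition otherwise. [folklore] -/
theorem ladderInt_twoTerm (L i k : ℕ) (hik : i ≤ k) (hkL : k + 1 ≤ L) {x : ℝ} (hx : 0 ≤ x) (r s : ℤ)
    (hs : s = 0 ∨ s = 1) :
    pathKernel (discreteDomainGraph (rectDomain L 1) 1) x (st i r) (st (k + 1 : ℕ) s) =
      ENNReal.ofReal x *
        (pathKernel (discreteDomainGraph (rectDomain k 1) 1) x (st i r) (st k s) +
          ENNReal.ofReal (x + ∑ d ∈ Finset.range (L - (k + 1)), x ^ (2 * d + 3)) *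
            pathKernel (discreteDomainGraph (rectDomain k 1) 1) x (st i r) (st k (1 - s))) := by
  rcases Nat.eq_or_lt_of_le hkL with rfl | hlt
  · rw [ladderInt_rec k i hik hx r s hs, Nat.sub_self, Finset.sum_range_zero, add_zero]
  · obtain ⟨m, rfl⟩ : ∃ m, L = k + 2 + m := ⟨L - (k + 2), by omega⟩
    rw [ladderInt_threeTerm i k m hik hx r s hs, show k + 2 + m - (k + 1) = m + 1 by omega]

/-! ## The stub -/

/-- **Tool stub `stub_ladderKernels_interior`.** All two-point kernels of the ladder `{0..L}×{0,1}`
between different columns: for `i < j ≤ L`, `r, s ∈ {0,1}`, `x ≥ 0`, with `E_k = Σ_{d<k} x^{2d+3}`,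
`F^{ε}_n = ((1+x)^n + ε (1-x)^n)/2` and `ε = +1` if `r = s`, `-1` otherwise,
`Z_{R_L}((i,r),(j,s)) = x^{j-i} (F^{ε}_{j-i+1} + (E_i + E_{L-j}) F^{-ε}_{j-i} + E_i E_{L-j} F^{ε}_{j-i-1})`
(an optional U-turn excursion left of column `i`, a monotone zigzag, an optional U-turn excursion right
of column `j`). Proof: `ladderInt_twoTerm` and the end-column kernels `ladderInt_endKernel`. [folklore] -/
theorem stub_ladderKernels_interior (L i j : ℕ) (hij : i < j) (hjL : j ≤ L) {x : ℝ} (hx : 0 ≤ x) (r s : ℤ)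
    (hr : r = 0 ∨ r = 1) (hs : s = 0 ∨ s = 1) :
    pathKernel (discreteDomainGraph (rectDomain L 1) 1) x (st i r) (st j s) =
      ENNReal.ofReal (x ^ (j - i) *
        (((1 + x) ^ (j - i + 1) + (if r = s then 1 else -1) * (1 - x) ^ (j - i + 1)) / 2 +
          ((∑ d ∈ Finset.range i, x ^ (2 * d + 3)) + ∑ d ∈ Finset.range (L - j), x ^ (2 * d + 3)) *
            (((1 + x) ^ (j - i) - (if r = s then 1 else -1) * (1 - x) ^ (j - i)) / 2) +
          (∑ d ∈ Finset.range i, x ^ (2 * d + 3)) * (∑ d ∈ Finset.range (L - j), x ^ (2 * d + 3)) *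
            (((1 + x) ^ (j - i - 1) + (if r = s then 1 else -1) * (1 - x) ^ (j - i - 1)) / 2))) := by
  obtain ⟨n, rfl⟩ : ∃ n, j = i + n + 1 := ⟨j - i - 1, by omega⟩
  rw [ladderInt_twoTerm L i (i + n) (Nat.le_add_right i n) hjL hx r s hs,
    ladderInt_endKernel i n hx r s hr hs, ladderInt_endKernel i n hx r (1 - s) hr (by omega)]
  have hA := ladderInt_endForm_nonneg hx n i (ite_eq_or_eq (P := r = s) (1 : ℝ) (-1))
  have hB := ladderInt_endForm_nonneg hx n i (ite_eq_or_eq (P := r = 1 - s) (1 : ℝ) (-1))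
  have hE : 0 ≤ x + ∑ d ∈ Finset.range (L - (i + n + 1)), x ^ (2 * d + 3) :=
    add_nonneg hx (Finset.sum_nonneg fun d _ => pow_nonneg hx _)
  rw [← ENNReal.ofReal_mul hE, ← ENNReal.ofReal_add hA (mul_nonneg hE hB), ← ENNReal.ofReal_mul hx]
  congr 1
  have hε : (if r = 1 - s then (1 : ℝ) else -1) = -(if r = s then (1 : ℝ) else -1) := by
    rcases hr with rfl | rfl <;> rcases hs with rfl | rfl <;> norm_num
  have e1 : i + n + 1 - i = n + 1 := by omega
  have e3 : n + 1 - 1 = n := rfl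
  rw [hε, e1, e3]
  ring

end Summit.CriticalPhenomena.SAWScalingLimit.Theorems.BoundaryTP2
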